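/-
Copyright (c) 2026 the pub-hodgecm-mathlib formalisation cell (harness21).  Prover seat hodgecm-mathlib-LH4-p13 (g8), req620 Track A «(D-RAM) FOUR-FRAME» squad, tier 0,
STAGE-1b PRE-SCOPING (heir LEAD F0P3a-plan (g20) T19-24 «allowed as scoping»; dealer LH4-plan (g12) WORD #45 «FIRST IN LINE for the (L-lab) producer»): organ (L-lab)
«THE LABEL LAW» of the rows `stub_rows_transvPlus ∕ stub_rows_transvMinus` — brick (L-lab-7) «THE T₊ LABEL TOKEN AND THE LABELLED COUNTS IN THE UNIMODULAR DIAGONAL MODEL»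
(the label twin of ★ p858764 `F0P3cDyRamLevelCountDiagonalModel`, which left the label token out «by design»).  2026-09-04.
-/
import Summits.HodgeConjecture.HodgeConjecture.Theorems.F0P3cDyRamLevelCountDiagonalModel   -- ★ p858764 (LH4-p09 (g8), (L-model)): `ncard_vertex_fixed_sep_formCongr_eq`, `latticeNearTransvShell_conj_mapGL_iff`,
                                                                                            -- `latticeInLevel_diagonal_mapGL_iff`, `coe_conj_sub_one`, `diagonal_conj_diagonal`, `diagonal_sub_one`, `diagonal_three_sub_one`, `eq_conj_of_coe_eq_frameElt`;
                                                                                            -- brings ★ `exists_unimodular_diagonal_frame`, ★ `exists_mem_mapGL_pairing_conj_iff`, ★ U2G DEFS (`LatticeLabelPlus`, `transvPlusFixCount`, …)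
import HarnessLib

/-!
# Crux `H413`, line LH4 «(D-RAM) FOUR-FRAME», tier 0, STAGE-1b pre-scoping — (L-lab-7): the `T₊` LABEL TOKEN and the LABELLED fixed-vertex counts
# `transvPlusFixCount ∕ transvMinusFixCount` of a frame element IN THE UNIMODULAR DIAGONAL MODEL (form-parametrised value sets; step (1) «form transport» and
# step (2) «class-only dependence» of the (K)∕(S) reductions for the LABELLED rows)

Cell `hodgecm-mathlib` (D-0151), FLOOR 0, crux item H413 = `stmt-HodgeConjecture-24833`, route of record `HCCMUnconditional`; squad F0∕P3c∕LH4.  SCOPING INVENTORY for the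
LEAD's PLAN-T1 v19 (L-lab)∕(L-T+) paragraphs; THEOREMS ONLY (no `def`, no instance, no notation, no `sorry`, default heartbeats), ★-only imports, lane
`--supports stmt-HodgeConjecture-24833 --as helper`; pays NO row, states NO law.

WHY.  ★ p858764 (L-model) moves every LEVEL token of the STAGE-1b censuses into the unimodular diagonal model `(K³, diag(c))`, `Γ_b(α, β) = A·diag(α, β, 1)·A⁻¹`,
`ᵗσ(A)Φ₃A = diag(c)`, `ω(c_i) = ω(N(f b i))` — and says «NOT INCLUDED (by design): the `T₊` LABEL token (★ U2G DEFS `latticeValueSetMod` hard-wires `Φ₃`; the value token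
transports by ★ `exists_mem_mapGL_pairing_conj_iff` once a form-parametrised label is cut)».  The rows `stub_rows_transvPlus ∕ _transvMinus` read exactly that token
(`transvPlusFixCount σ ϖ d ℓ m Γ = #{M type 0 | ΓM = M ∧ LatticeNearTransvShell ϖ ℓ m (Γ−1) M ∧ LatticeLabelPlus σ ϖ d m M (Γ−1)}`).  This file supplies the transport
DEF-FREE: the model label is written as the explicit set-builder
  `{v | ∃ y ∈ M, |(ϖ^m)⁻¹·(v − ⟨y, X y⟩_{H′})| ≤ 1} = valueSetMod σ ϖ m (xPlus σ ϖ d)`   (`⟨·,·⟩_{H′} = pairing σ H′`, `H′ = ᵗσ(A)Φ₃A`),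
and in the diagonal model `H′ = diag(c)`, `X = diag(α − 1, β − 1, 0)` the value is the BINARY NORM FORM `⟨y, X y⟩_{diag(c)} = c₀(α−1)·N(y₀) + c₁(β−1)·N(y₁)` (`N(a) = a·σa`) —
★ (L-lab-0) `pairing_frameElt_sub_one_mulVec` with the frame functionals straightened to coordinates and the norms `N(f b i)⁻¹` replaced by the model units `c_i` of the
SAME norm classes (the κ-data `signPair b`).

* §1 `pairing_diagonal_mulVec_diagonal` (`⟨y, diag(e) y⟩_{diag(c)} = Σ σ(y_i)·c_i·(e_i·y_i)`), `pairing_diagonal_mulVec_diagonal_three` (the binary norm form at `e = (a, b, 0)`).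
* §2 TRANSPORT OF THE VALUE TOKEN: **`latticeValueSetMod_conj_mapGL_eq`** (`latticeValueSetMod σ ϖ m (P·M) (PXP⁻¹)` = the `H′ = ᵗσ(P)Φ₃P` value set of `X` on `M`),
  **`latticeLabelPlus_conj_mapGL_iff`**.
* §3 THE LABELLED COUNTS OF A CONJUGATE: **`transvPlusFixCount_conj_eq`** ∕ **`transvMinusFixCount_conj_eq`** (any model `ᵗσ(A)Φ₃A = H′`, any `T`, `Γ = ATA⁻¹`: the ★ U2G
  count = the model count with shell tokens of `T − 1` and the `H′`-value-set label), and the diagonal instances **`transvPlusFixCount_conj_diagonal`** ∕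
  **`transvMinusFixCount_conj_diagonal`** (`T = diag(s)`: shell tokens of `diag(s − 1)`, `diag((s−1)²)`, label = the binary∕ternary norm form `Σ c_i(s_i − 1)N(y_i)`).
* §4 CLASS-ONLY DEPENDENCE (step (2)): **`ncard_labelled_diagonal_eq_of_exists_norm`** — two unit diagonal forms `diag(c)`, `diag(c′)` with `c′_i = σ(z_i)·c_i·z_i` give the
  same labelled model counts (`diag(z)` is a congruence commuting with `diag(s)`; the value token follows it by ★ `exists_mem_mapGL_pairing_conj_iff`): the labelled counts
  of a frame depend on `(c₀, c₁, c₂)` only through the classes `ω(c_i)` — for the frames, through `signPair b`.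
* §5 HEADS: **`exists_diagonal_model_transvFixCounts`** — for a four-frame family and a frame `b` there are `A`, `c` (units, `σ`-fixed, `ω(c_i) = ω(N(f b i))`) with, for ALL
  `α, β`, `T = diag(α, β, 1)`, `Γ = Γ_b(α, β)` and all `d, ℓ, m`: `transvPlusFixCount σ ϖ d ℓ m Γ` (resp. `Minus`) `=` the number of type-0 vertices `M` of `(K³, diag(c))` with
  `T·M = M`, `diag(α−1, β−1, 0)M ⊆ ϖ^ℓM ⊄ ϖ^{ℓ+1}M`, `diag((α−1)², (β−1)², 0)M ⊆ ϖ^mM`, and (resp. not)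
  `{v | ∃ y ∈ M, |(ϖ^m)⁻¹(v − (c₀(α−1)N(y₀) + c₁(β−1)N(y₁)))| ≤ 1} = valueSetMod σ ϖ m (xPlus σ ϖ d)`.
  With ★ p858764's heads this puts ALL FIVE tier-0 piece censuses in ONE model; the (L-T+) producer's census is a count over the ★ Stage-A∕B strata of `(diag(c), diag(α, β, 1))`
  cut by the binary norm-form class above (one-slot strata: ★ (L-lab-1)∕(L-lab-3)∕(L-lab-5) decide it; glued strata: the genuine binary form).
HONEST LABEL.  Count-neutral scoping brick (a change of model, nothing printed is asserted); the three tier-0 rows stay OPEN; `HC_CM` is proved only modulo the 7 printed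
citations (2 remaining named inputs: hLiu418 = `stmt-HodgeConjecture-24832`, h413 = `stmt-HodgeConjecture-24833`) until rung 0 closes.

## References
* [BruhatTits1972] F. Bruhat, J. Tits, *Groupes réductifs sur un corps local I*, Publ. Math. IHÉS 41 (1972), §10 (lattice models of the building; change of frame).
* [Jacobowitz1962] R. Jacobowitz, *Hermitian forms over local fields*, Amer. J. Math. 84 (1962), §4 (Gram matrices, scaling, norm classes of diagonal forms).
* [Kottwitz1986BaseChangeUnits] R. E. Kottwitz, *Base change for unit elements of Hecke algebras*, Compositio Math. 60 (1986), §1 pp. 240–241 (fixed-lattice counting).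
* [Rogawski1990] J. D. Rogawski, *Automorphic Representations of Unitary Groups in Three Variables*, Ann. of Math. Stud. 123 (1990), §3.6 pp. 28–29 (elliptic tori and
  frames), §4.9 Prop. 4.9.1 (a)(b) p. 55 (orbital integrals as fixed-lattice counts; the two transvection classes).
* [LanglandsShelstad1987] R. P. Langlands, D. Shelstad, *On the definition of transfer factors*, Math. Ann. 278 (1987), §3 (the κ-signs of the four frames).
-/

set_option autoImplicit false

noncomputable section

namespace Summit.HodgeConjecture.HodgeConjecture.Cruxes.H413.F0P3cDyRamLabelCountDiagonalModel

open Literature.NumberTheory.Automorphic Literature.NumberTheory.Automorphic.HermitianLattice Literature.NumberTheory.Automorphic.UnitaryGroup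
open Literature.NumberTheory.Automorphic.UnitaryLatticeTree Literature.NumberTheory.Automorphic.UnitaryThreeFourFrame
open Summit.HodgeConjecture.HodgeConjecture.Cruxes.H413.F0P3cDyRamFourFramePieces
open Summit.HodgeConjecture.HodgeConjecture.Cruxes.H413.F0P3cDyRamFourFrameCensusDefs
open Summit.HodgeConjecture.HodgeConjecture.Cruxes.H413.F0P3cDyRamFixedCountDiagonalModel (exists_unimodular_diagonal_frame)
open Summit.HodgeConjecture.HodgeConjecture.Cruxes.H413.F0P3cDyRamLevelCountDiagonalModel
open scoped Valued WithZero Matrix MatrixGroups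

/-! ## §1  The value of a diagonal operator under a diagonal form: the binary ∕ ternary norm form -/

section Algebra

variable {K : Type*} [Field K] {N : ℕ}

/-- `⟨y, diag(e)·y⟩_{diag(c)} = Σ_i σ(y_i)·c_i·(e_i·y_i)` — under a diagonal form a diagonal operator takes the value of the diagonal norm form `Σ c_i e_i·N(y_i)`.
[cite: Jacobowitz1962, §4] -/
theorem pairing_diagonal_mulVec_diagonal (σ : K →+* K) (c e y : Fin N → K) :
    pairing σ (Matrix.diagonal c) y (Matrix.diagonal e *ᵥ y) = ∑ i, σ (y i) * c i * (e i * y i) := by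
  rw [pairing_apply]
  refine Finset.sum_congr rfl fun i _ => ?_
  rw [Finset.sum_eq_single i (fun j _ hj => by rw [Matrix.diagonal_apply_ne _ (Ne.symm hj), mul_zero, zero_mul])
    (fun h => absurd (Finset.mem_univ i) h), Matrix.diagonal_apply_eq, Matrix.mulVec_diagonal]

/-- The frame-element instance: `⟨y, diag(a, b, 0)·y⟩_{diag(c)} = c₀·a·(y₀·σy₀) + c₁·b·(y₁·σy₁)` — ★ (L-lab-0) `pairing_frameElt_sub_one_mulVec` in model coordinates
(`a = α − 1`, `b = β − 1`; the model units `c_i` carry the norm classes `ω(N(f b i))`). [cite: Jacobowitz1962, §4] [cite: Rogawski1990, §4.9 Prop. 4.9.1 (b) p. 55] -/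
theorem pairing_diagonal_mulVec_diagonal_three (σ : K →+* K) (c : Fin 3 → K) (a b : K) (y : Fin 3 → K) :
    pairing σ (Matrix.diagonal c) y (Matrix.diagonal ![a, b, 0] *ᵥ y) = c 0 * a * (y 0 * σ (y 0)) + c 1 * b * (y 1 * σ (y 1)) := by
  rw [pairing_diagonal_mulVec_diagonal, Fin.sum_univ_three]
  simp only [Matrix.cons_val_zero, Matrix.cons_val_one, Matrix.head_cons, Matrix.cons_val_two, Matrix.tail_cons, zero_mul, mul_zero, add_zero]
  ring

/-- `(diag(s) − 1)·(diag(s) − 1) = diag((s−1)²)` in the `fun`-spelling produced by ★ `diagonal_sub_one`. [cite: Rogawski1990, §3.6 pp. 28–29] -/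
theorem diagonal_sub_one_mul_self' (s : Fin N → K) :
    (Matrix.diagonal fun i => s i - 1) * (Matrix.diagonal fun i => s i - 1) = Matrix.diagonal fun i => (s i - 1) * (s i - 1) := by
  rw [Matrix.diagonal_mul_diagonal]

end Algebra

/-! ## §2  Transport of the value token and of the label under `M ↦ P·M`, `X ↦ PXP⁻¹` -/

section Transport

variable {K : Type*} [Field K] [Valued K ℤᵐ⁰] {N : ℕ}

/-- **THE VALUE TOKEN TRANSPORTS** (★ U2G DEFS currency): `latticeValueSetMod σ ϖ m (P·M) (PXP⁻¹)` is the `ϖ^m`-thickened set of the values `⟨y, X y⟩_{H′}`, `y ∈ M`, for the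
congruent form `H′ = ᵗσ(P)Φ₃P` (★ `exists_mem_mapGL_pairing_conj_iff` with the predicate `w ↦ |(ϖ^m)⁻¹(v − w)| ≤ 1`). [cite: Jacobowitz1962, §4] [cite: Kottwitz1986BaseChangeUnits, §1 pp. 240–241] -/
theorem latticeValueSetMod_conj_mapGL_eq (σ : K →+* K) (ϖ : K) (m : ℕ) (P : GL (Fin 3) K) (X : Matrix (Fin 3) (Fin 3) K) (M : Submodule 𝒪[K] (Fin 3 → K)) :
    latticeValueSetMod σ ϖ m (mapGL P M) ((P : Matrix (Fin 3) (Fin 3) K) * X * ((P⁻¹ : GL (Fin 3) K) : Matrix (Fin 3) (Fin 3) K)) =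
      {v | ∃ y ∈ M, Valued.v ((ϖ ^ m)⁻¹ * (v - pairing σ (formCongr σ P ((StdForm.antidiagonal 3).over K)) y (X *ᵥ y))) ≤ 1} := by
  ext v
  simp only [latticeValueSetMod, Set.mem_setOf_eq]
  exact exists_mem_mapGL_pairing_conj_iff σ ((StdForm.antidiagonal 3).over K) P X M (fun w => Valued.v ((ϖ ^ m)⁻¹ * (v - w)) ≤ 1)

/-- **THE LABEL TRANSPORTS**: `LatticeLabelPlus σ ϖ d m (P·M) (PXP⁻¹) ↔` «the `H′`-value set of `X` on `M`, thickened by `ϖ^m`, equals `valueSetMod σ ϖ m (xPlus σ ϖ d)`» —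
the form-parametrised label ★ p858764 asked for, def-free. [cite: Rogawski1990, §4.9 Prop. 4.9.1 (b) p. 55] [cite: BruhatTits1972, §10] -/
theorem latticeLabelPlus_conj_mapGL_iff (σ : K →+* K) (ϖ : K) (d m : ℕ) (P : GL (Fin 3) K) (X : Matrix (Fin 3) (Fin 3) K) (M : Submodule 𝒪[K] (Fin 3 → K)) :
    LatticeLabelPlus σ ϖ d m (mapGL P M) ((P : Matrix (Fin 3) (Fin 3) K) * X * ((P⁻¹ : GL (Fin 3) K) : Matrix (Fin 3) (Fin 3) K)) ↔
      {v | ∃ y ∈ M, Valued.v ((ϖ ^ m)⁻¹ * (v - pairing σ (formCongr σ P ((StdForm.antidiagonal 3).over K)) y (X *ᵥ y))) ≤ 1} =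
        valueSetMod σ ϖ m (xPlus σ ϖ d) := by
  rw [LatticeLabelPlus, latticeValueSetMod_conj_mapGL_eq]

/-! ## §3  The labelled counts of a conjugate `Γ = A·T·A⁻¹` in the model `H′ = ᵗσ(A)Φ₃A` -/

/-- **`transvPlusFixCount` OF A CONJUGATE** (any model `ᵗσ(A)·Φ₃·A = H′`, any `T`): for `Γ = A·T·A⁻¹`,
`transvPlusFixCount σ ϖ d ℓ m Γ = #{M : type 0 for H′, T·M = M, LatticeNearTransvShell ϖ ℓ m (T−1) M, ‹H′-value set of T−1 on M› = valueSetMod (X₊)}` — the shell tokens by ★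
`latticeNearTransvShell_conj_mapGL_iff`, the label by §2. [cite: Kottwitz1986BaseChangeUnits, §1 pp. 240–241] [cite: Rogawski1990, §4.9 Prop. 4.9.1 (b) p. 55] [cite: BruhatTits1972, §10] -/
theorem transvPlusFixCount_conj_eq (σ : K →+* K) (ϖ : K) {H' : Matrix (Fin 3) (Fin 3) K} {A T Γ : GL (Fin 3) K}
    (hA : formCongr σ A ((StdForm.antidiagonal 3).over K) = H') (hΓ : Γ = A * T * A⁻¹) (d ℓ m : ℕ) :
    transvPlusFixCount σ ϖ d ℓ m Γ =
      {M : Submodule 𝒪[K] (Fin 3 → K) | IsVertexLattice σ ϖ H' 0 M ∧ mapGL T M = M ∧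
        (LatticeNearTransvShell ϖ ℓ m ((T : Matrix (Fin 3) (Fin 3) K) - 1) M ∧
          {v | ∃ y ∈ M, Valued.v ((ϖ ^ m)⁻¹ * (v - pairing σ H' y (((T : Matrix (Fin 3) (Fin 3) K) - 1) *ᵥ y))) ≤ 1} =
            valueSetMod σ ϖ m (xPlus σ ϖ d))}.ncard := by
  subst hΓ
  unfold transvPlusFixCount
  rw [← hA]
  refine (ncard_vertex_fixed_sep_formCongr_eq σ ϖ ((StdForm.antidiagonal 3).over K) A T 0 _ _ fun M => ?_).symm
  rw [F0P3cDyRamLevelCountDiagonalModel.coe_conj_sub_one, latticeNearTransvShell_conj_mapGL_iff, latticeLabelPlus_conj_mapGL_iff]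

/-- **`transvMinusFixCount` OF A CONJUGATE**: the same with the label negated. [cite: Kottwitz1986BaseChangeUnits, §1 pp. 240–241] [cite: Rogawski1990, §4.9 Prop. 4.9.1 (b) p. 55] -/
theorem transvMinusFixCount_conj_eq (σ : K →+* K) (ϖ : K) {H' : Matrix (Fin 3) (Fin 3) K} {A T Γ : GL (Fin 3) K}
    (hA : formCongr σ A ((StdForm.antidiagonal 3).over K) = H') (hΓ : Γ = A * T * A⁻¹) (d ℓ m : ℕ) :
    transvMinusFixCount σ ϖ d ℓ m Γ =
      {M : Submodule 𝒪[K] (Fin 3 → K) | IsVertexLattice σ ϖ H' 0 M ∧ mapGL T M = M ∧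
        (LatticeNearTransvShell ϖ ℓ m ((T : Matrix (Fin 3) (Fin 3) K) - 1) M ∧
          ¬ {v | ∃ y ∈ M, Valued.v ((ϖ ^ m)⁻¹ * (v - pairing σ H' y (((T : Matrix (Fin 3) (Fin 3) K) - 1) *ᵥ y))) ≤ 1} =
            valueSetMod σ ϖ m (xPlus σ ϖ d))}.ncard := by
  subst hΓ
  unfold transvMinusFixCount
  rw [← hA]
  refine (ncard_vertex_fixed_sep_formCongr_eq σ ϖ ((StdForm.antidiagonal 3).over K) A T 0 _ _ fun M => ?_).symm
  rw [F0P3cDyRamLevelCountDiagonalModel.coe_conj_sub_one, latticeNearTransvShell_conj_mapGL_iff, latticeLabelPlus_conj_mapGL_iff]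

/-- **`transvPlusFixCount` OF A CONJUGATE OF A DIAGONAL MATRIX** (`T = diag(s)`, model `H′ = diag(c)`): shell tokens of `diag(s − 1)`, `diag((s−1)²)` and the label
«`{Σ_i σ(y_i)·c_i·((s_i − 1)·y_i) | y ∈ M} + ϖ^m𝒪 = t₊·N(𝒪) + ϖ^m𝒪`». [cite: Kottwitz1986BaseChangeUnits, §1 pp. 240–241] [cite: Jacobowitz1962, §4] -/
theorem transvPlusFixCount_conj_diagonal (σ : K →+* K) (ϖ : K) {c : Fin 3 → K} {A T Γ : GL (Fin 3) K}
    (hA : formCongr σ A ((StdForm.antidiagonal 3).over K) = Matrix.diagonal c) (hΓ : Γ = A * T * A⁻¹) {s : Fin 3 → K}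
    (hT : (T : Matrix (Fin 3) (Fin 3) K) = Matrix.diagonal s) (d ℓ m : ℕ) :
    transvPlusFixCount σ ϖ d ℓ m Γ =
      {M : Submodule 𝒪[K] (Fin 3 → K) | IsVertexLattice σ ϖ (Matrix.diagonal c) 0 M ∧ mapGL T M = M ∧
        ((LatticeInLevel ϖ ℓ (Matrix.diagonal fun i => s i - 1) M ∧ ¬ LatticeInLevel ϖ (ℓ + 1) (Matrix.diagonal fun i => s i - 1) M ∧
            LatticeInLevel ϖ m (Matrix.diagonal fun i => (s i - 1) * (s i - 1)) M) ∧
          {v | ∃ y ∈ M, Valued.v ((ϖ ^ m)⁻¹ * (v - ∑ i, σ (y i) * c i * ((s i - 1) * y i))) ≤ 1} = valueSetMod σ ϖ m (xPlus σ ϖ d))}.ncard := by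
  rw [transvPlusFixCount_conj_eq σ ϖ hA hΓ, hT, diagonal_sub_one]
  unfold LatticeNearTransvShell
  rw [diagonal_sub_one_mul_self']
  simp only [pairing_diagonal_mulVec_diagonal]

/-- **`transvMinusFixCount` OF A CONJUGATE OF A DIAGONAL MATRIX**: the same with the label negated. [cite: Kottwitz1986BaseChangeUnits, §1 pp. 240–241] [cite: Jacobowitz1962, §4] -/
theorem transvMinusFixCount_conj_diagonal (σ : K →+* K) (ϖ : K) {c : Fin 3 → K} {A T Γ : GL (Fin 3) K}
    (hA : formCongr σ A ((StdForm.antidiagonal 3).over K) = Matrix.diagonal c) (hΓ : Γ = A * T * A⁻¹) {s : Fin 3 → K}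
    (hT : (T : Matrix (Fin 3) (Fin 3) K) = Matrix.diagonal s) (d ℓ m : ℕ) :
    transvMinusFixCount σ ϖ d ℓ m Γ =
      {M : Submodule 𝒪[K] (Fin 3 → K) | IsVertexLattice σ ϖ (Matrix.diagonal c) 0 M ∧ mapGL T M = M ∧
        ((LatticeInLevel ϖ ℓ (Matrix.diagonal fun i => s i - 1) M ∧ ¬ LatticeInLevel ϖ (ℓ + 1) (Matrix.diagonal fun i => s i - 1) M ∧
            LatticeInLevel ϖ m (Matrix.diagonal fun i => (s i - 1) * (s i - 1)) M) ∧
          ¬ {v | ∃ y ∈ M, Valued.v ((ϖ ^ m)⁻¹ * (v - ∑ i, σ (y i) * c i * ((s i - 1) * y i))) ≤ 1} = valueSetMod σ ϖ m (xPlus σ ϖ d))}.ncard := by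
  rw [transvMinusFixCount_conj_eq σ ϖ hA hΓ, hT, diagonal_sub_one]
  unfold LatticeNearTransvShell
  rw [diagonal_sub_one_mul_self']
  simp only [pairing_diagonal_mulVec_diagonal]

/-! ## §4  Class-only dependence of the labelled model counts -/

/-- **(C) CLASS-ONLY DEPENDENCE OF THE LABELLED COUNTS.**  If two diagonal forms `diag(c)`, `diag(c′)` differ entrywise by norms — `σ(z_i)·c_i·z_i = c′_i`, `z_i ≠ 0` — then
for every diagonal `T = diag(s)`, every level data `(ℓ, m)` and every reading `F` of the label equation (`F = id`: label `+`; `F = Not`: label `−`), the label-cut type-0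
fixed counts of the two models agree: `diag(z)` is a congruence `diag(c) → diag(c′)` commuting with `T` and with the level operators (★ `latticeInLevel_diagonal_mapGL_iff`),
and the value token follows it (★ `exists_mem_mapGL_pairing_conj_iff`).  So the labelled counts of a frame depend on the model units only through `(ω(c₀), ω(c₁), ω(c₂))`.
[cite: Jacobowitz1962, §4] [cite: BruhatTits1972, §10] [cite: LanglandsShelstad1987, §3] -/
theorem ncard_labelled_diagonal_eq_of_exists_norm (σ : K →+* K) (ϖ : K) {c c' : Fin 3 → K} (h : ∀ i, ∃ z : K, z ≠ 0 ∧ σ z * c i * z = c' i)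
    (s : Fin 3 → K) (T : GL (Fin 3) K) (hT : (T : Matrix (Fin 3) (Fin 3) K) = Matrix.diagonal s) (d ℓ m : ℕ) (F : Prop → Prop) :
    {M : Submodule 𝒪[K] (Fin 3 → K) | IsVertexLattice σ ϖ (Matrix.diagonal c') 0 M ∧ mapGL T M = M ∧
        ((LatticeInLevel ϖ ℓ (Matrix.diagonal fun i => s i - 1) M ∧ ¬ LatticeInLevel ϖ (ℓ + 1) (Matrix.diagonal fun i => s i - 1) M ∧
            LatticeInLevel ϖ m (Matrix.diagonal fun i => (s i - 1) * (s i - 1)) M) ∧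
          F ({v | ∃ y ∈ M, Valued.v ((ϖ ^ m)⁻¹ * (v - ∑ i, σ (y i) * c' i * ((s i - 1) * y i))) ≤ 1} = valueSetMod σ ϖ m (xPlus σ ϖ d)))}.ncard =
      {M : Submodule 𝒪[K] (Fin 3 → K) | IsVertexLattice σ ϖ (Matrix.diagonal c) 0 M ∧ mapGL T M = M ∧
        ((LatticeInLevel ϖ ℓ (Matrix.diagonal fun i => s i - 1) M ∧ ¬ LatticeInLevel ϖ (ℓ + 1) (Matrix.diagonal fun i => s i - 1) M ∧
            LatticeInLevel ϖ m (Matrix.diagonal fun i => (s i - 1) * (s i - 1)) M) ∧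
          F ({v | ∃ y ∈ M, Valued.v ((ϖ ^ m)⁻¹ * (v - ∑ i, σ (y i) * c i * ((s i - 1) * y i))) ≤ 1} = valueSetMod σ ϖ m (xPlus σ ϖ d)))}.ncard := by
  classical
  choose z hz0 hz using h
  let P : GL (Fin 3) K :=
    ⟨Matrix.diagonal z, Matrix.diagonal fun i => (z i)⁻¹,
      by rw [Matrix.diagonal_mul_diagonal, ← Matrix.diagonal_one]; congr 1; funext i; exact mul_inv_cancel₀ (hz0 i),
      by rw [Matrix.diagonal_mul_diagonal, ← Matrix.diagonal_one]; congr 1; funext i; exact inv_mul_cancel₀ (hz0 i)⟩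
  have hP : (P : Matrix (Fin 3) (Fin 3) K) = Matrix.diagonal z := rfl
  have hform : formCongr σ P (Matrix.diagonal c) = Matrix.diagonal c' := by
    rw [formCongr, hP, Matrix.diagonal_map (map_zero σ), Matrix.diagonal_transpose, Matrix.diagonal_mul_diagonal, Matrix.diagonal_mul_diagonal]
    congr 1; funext i; exact hz i
  have hcomm : P * T * P⁻¹ = T := Units.ext (by rw [Units.val_mul, Units.val_mul, hT, diagonal_conj_diagonal hP])
  -- the value token in the two models
  have hlab : ∀ M : Submodule 𝒪[K] (Fin 3 → K),
      {v | ∃ y ∈ mapGL P M, Valued.v ((ϖ ^ m)⁻¹ * (v - ∑ i, σ (y i) * c i * ((s i - 1) * y i))) ≤ 1} =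
        {v | ∃ y ∈ M, Valued.v ((ϖ ^ m)⁻¹ * (v - ∑ i, σ (y i) * c' i * ((s i - 1) * y i))) ≤ 1} := by
    intro M
    ext v
    simp only [Set.mem_setOf_eq]
    have key := exists_mem_mapGL_pairing_conj_iff σ (Matrix.diagonal c) P (Matrix.diagonal fun i => s i - 1) M
      (fun w => Valued.v ((ϖ ^ m)⁻¹ * (v - w)) ≤ 1)
    rw [diagonal_conj_diagonal hP, hform] at key
    simpa only [pairing_diagonal_mulVec_diagonal] using key
  have key := ncard_vertex_fixed_sep_formCongr_eq σ ϖ (Matrix.diagonal c) P T 0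
    (fun M => (LatticeInLevel ϖ ℓ (Matrix.diagonal fun i => s i - 1) M ∧ ¬ LatticeInLevel ϖ (ℓ + 1) (Matrix.diagonal fun i => s i - 1) M ∧
        LatticeInLevel ϖ m (Matrix.diagonal fun i => (s i - 1) * (s i - 1)) M) ∧
      F ({v | ∃ y ∈ M, Valued.v ((ϖ ^ m)⁻¹ * (v - ∑ i, σ (y i) * c i * ((s i - 1) * y i))) ≤ 1} = valueSetMod σ ϖ m (xPlus σ ϖ d)))
    (fun M => (LatticeInLevel ϖ ℓ (Matrix.diagonal fun i => s i - 1) M ∧ ¬ LatticeInLevel ϖ (ℓ + 1) (Matrix.diagonal fun i => s i - 1) M ∧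
        LatticeInLevel ϖ m (Matrix.diagonal fun i => (s i - 1) * (s i - 1)) M) ∧
      F ({v | ∃ y ∈ M, Valued.v ((ϖ ^ m)⁻¹ * (v - ∑ i, σ (y i) * c' i * ((s i - 1) * y i))) ≤ 1} = valueSetMod σ ϖ m (xPlus σ ϖ d)))
    (fun M => by rw [latticeInLevel_diagonal_mapGL_iff hP, latticeInLevel_diagonal_mapGL_iff hP, latticeInLevel_diagonal_mapGL_iff hP, hlab M])
  rw [← hform, key, hcomm]

end Transport

/-! ## §5  The four-frame heads: the labelled counts of `Γ_b(α, β)` in the unimodular diagonal model -/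

section Frame

variable {K : Type} [Field K] [Valued K ℤᵐ⁰] {σ : K →+* K} {ϖ : K}

/-- **HEAD — THE LABELLED CENSUS OF A FRAME ELEMENT IN THE UNIMODULAR DIAGONAL MODEL.**  Under the datum clauses (`σ` an involutive isometry whose fixed elements have even
valuation, `|ϖ| = exp(−1)`), for a four-frame family `f` and a frame `b` there is a unit diagonal form `diag(c)` — `|c_i| = 1`, `σ c_i = c_i`, `ω(c_i) = ω(N(f b i))` (so
`(ω(c₀), ω(c₁)) = signPair b`, the κ-data) — such that for ALL `α, β`, every `T ∈ GL₃` with matrix `diag(α, β, 1)`, every `Γ ∈ GL₃` with matrix `Γ_b(α, β) = frameElt σ f b α β`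
and all `d, ℓ, m`:  `transvPlusFixCount σ ϖ d ℓ m Γ` (resp. `transvMinusFixCount`) is the number of type-0 vertices `M` of `(K³, diag(c))` with `T·M = M`,
`diag(α−1, β−1, 0)·M ⊆ ϖ^ℓM`, `⊄ ϖ^{ℓ+1}M`, `diag((α−1)², (β−1)², 0)·M ⊆ ϖ^mM`, and (resp. not) the BINARY NORM-FORM CLASS
`{c₀(α−1)·N(y₀) + c₁(β−1)·N(y₁) | y ∈ M} + ϖ^m𝒪 = t₊·N(𝒪) + ϖ^m𝒪` (`= valueSetMod σ ϖ m (xPlus σ ϖ d)`).  Step (1) of the (K)∕(S) reductions for the rows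
`stub_rows_transvPlus ∕ _transvMinus`, in the SAME model as ★ p858764's level heads. [cite: Rogawski1990, §4.9 Prop. 4.9.1 (a)(b) p. 55] [cite: Kottwitz1986BaseChangeUnits, §1 pp. 240–241]
[cite: BruhatTits1972, §10] [cite: LanglandsShelstad1987, §3] -/
theorem exists_diagonal_model_transvFixCounts (hσ : ∀ x, σ (σ x) = x) (hvσ : ∀ a, Valued.v (σ a) = Valued.v a)
    (hϖ : Valued.v ϖ = WithZero.exp (-1 : ℤ)) (heven : ∀ x : K, σ x = x → x ≠ 0 → ∃ n : ℤ, Valued.v x = WithZero.exp (2 * n))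
    {f : Fin 4 → Fin 3 → (Fin 3 → K)} (hf : IsFourFrameFamily σ f) (b : Fin 4) :
    ∃ c : Fin 3 → K, (∀ i, Valued.v (c i) = 1) ∧ (∀ i, σ (c i) = c i) ∧
      (∀ i, normSign σ (c i) = normSign σ (pairing σ ((StdForm.antidiagonal 3).over K) (f b i) (f b i))) ∧
      ∀ (α β : K) (T Γ : GL (Fin 3) K), (T : Matrix (Fin 3) (Fin 3) K) = Matrix.diagonal ![α, β, 1] →
        (Γ : Matrix (Fin 3) (Fin 3) K) = frameElt σ f b α β → ∀ d ℓ m : ℕ,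
        transvPlusFixCount σ ϖ d ℓ m Γ =
            {M : Submodule 𝒪[K] (Fin 3 → K) | IsVertexLattice σ ϖ (Matrix.diagonal c) 0 M ∧ mapGL T M = M ∧
              ((LatticeInLevel ϖ ℓ (Matrix.diagonal ![α - 1, β - 1, 0]) M ∧ ¬ LatticeInLevel ϖ (ℓ + 1) (Matrix.diagonal ![α - 1, β - 1, 0]) M ∧
                  LatticeInLevel ϖ m (Matrix.diagonal ![(α - 1) * (α - 1), (β - 1) * (β - 1), 0]) M) ∧
                {v | ∃ y ∈ M, Valued.v ((ϖ ^ m)⁻¹ * (v - (c 0 * (α - 1) * (y 0 * σ (y 0)) + c 1 * (β - 1) * (y 1 * σ (y 1))))) ≤ 1} =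
                  valueSetMod σ ϖ m (xPlus σ ϖ d))}.ncard ∧
        transvMinusFixCount σ ϖ d ℓ m Γ =
            {M : Submodule 𝒪[K] (Fin 3 → K) | IsVertexLattice σ ϖ (Matrix.diagonal c) 0 M ∧ mapGL T M = M ∧
              ((LatticeInLevel ϖ ℓ (Matrix.diagonal ![α - 1, β - 1, 0]) M ∧ ¬ LatticeInLevel ϖ (ℓ + 1) (Matrix.diagonal ![α - 1, β - 1, 0]) M ∧
                  LatticeInLevel ϖ m (Matrix.diagonal ![(α - 1) * (α - 1), (β - 1) * (β - 1), 0]) M) ∧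
                ¬ {v | ∃ y ∈ M, Valued.v ((ϖ ^ m)⁻¹ * (v - (c 0 * (α - 1) * (y 0 * σ (y 0)) + c 1 * (β - 1) * (y 1 * σ (y 1))))) ≤ 1} =
                  valueSetMod σ ϖ m (xPlus σ ϖ d))}.ncard := by
  obtain ⟨A, c, hc, hσc, hcls, hA, hconj⟩ := exists_unimodular_diagonal_frame hσ hvσ hϖ heven hf b
  refine ⟨c, hc, hσc, hcls, fun α β T Γ hT hΓ d ℓ m => ?_⟩
  have hΓ' : Γ = A * T * A⁻¹ := eq_conj_of_coe_eq_frameElt hconj hT hΓ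
  have hD₁ : Matrix.diagonal ![α, β, (1 : K)] - 1 = Matrix.diagonal ![α - 1, β - 1, 0] := by rw [diagonal_three_sub_one, sub_self]
  have hD₂ : (Matrix.diagonal ![α, β, (1 : K)] - 1) * (Matrix.diagonal ![α, β, 1] - 1) = Matrix.diagonal ![(α - 1) * (α - 1), (β - 1) * (β - 1), 0] := by
    rw [diagonal_three_sub_one_mul_self, sub_self, mul_zero]
  constructor
  · rw [transvPlusFixCount_conj_eq σ ϖ hA hΓ', hT]
    unfold LatticeNearTransvShell
    rw [hD₂, hD₁]
    simp only [pairing_diagonal_mulVec_diagonal_three]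
  · rw [transvMinusFixCount_conj_eq σ ϖ hA hΓ', hT]
    unfold LatticeNearTransvShell
    rw [hD₂, hD₁]
    simp only [pairing_diagonal_mulVec_diagonal_three]

end Frame

end Summit.HodgeConjecture.HodgeConjecture.Cruxes.H413.F0P3cDyRamLabelCountDiagonalModel

end
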